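import Summits.QuantumFields.BalabanUV.Beta.GAN24.SlavedSummandLetterRows
import Summits.QuantumFields.BalabanUV.Beta.GAN24.ThirdJetThreeKernel
import Summits.QuantumFields.BalabanUV.Beta.GAN24.WardResidualSUnroll

/-!
# `BalabanUV.Beta.GAN24.SlavedSummandLetterDriftRows` — binder row G-an2-4 ∕ (CONV-C), W-slot EXIT (α) (RULING R-lead-g77-1 (2); the (α-0) parity re-cut, piece (α-END-b′) —
# the even member's cell DRIFT row `hcelld`, SLOT half), PART 1 of the drift twin of `BlockCommutatorStepLetter`: **THE ONE-STEP DIFFERENCE OF THE SLAVED THIRD JET OF A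
# COMMUTATOR-FACTOR FAMILY — leaf-03 g66's `SlavedSummandLetterRows` letter rows for `e3OfK N K′ (G′ p) − e3OfK N K (G p)`, with constant LINEAR in the kernel difference
# `Decays (K′ − K) CD` and the table difference `LocStencil (F′ − F) CFd`** (generic `d`; road-P2 chair of row G-an2-4, unit `b2b-balaban-gan24-p2` gen 45, crux team (2);
# leaf-01 g72's located row (ii′), A-5 l.51007 «the drift twin of p2's INTENT 2 … first refusal p2 g45»; the level instance is PART 2 `GAN24/BlockCommutatorStepLetterDrift`)

NOT IN PRINT; OUR BOOKKEEPING ([folklore] kernel algebra + composition BY NAME; 0 `def`, 0 cited facts, 0 `def … : Prop`, 0 sorry).  HONEST FRAMING (cell contract,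
verbatim): «discharging `BetaPertH` makes Bałaban's UV stability UNCONDITIONAL — a real constructive-QFT result; it is NOT the continuum limit and NOT the Clay problem.»
HONEST DEPENDENCY (verbatim): «continuum YM on T⁴ ⇐ BetaPertH ∧ nine spine estimates (0/9 proved); BetaPertH ⇐ (D1) ∧ (D4) ∧ CAP+tail; G-an2-4 gates asym, D1 and
NE2/3/4.»

WHAT (leaf-03 g15's three-leg third jet `e3K3 X Y Z N S κ′ u′ := −mmRead N (X ∘ vertexOfK Y N S κ′ u′ ∘ Z)` (`ThirdJetThreeKernel`), whose diagonal `e3K3 K K K N S` IS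
an5's `e3OfK N K S` by `rfl`; a COMMUTATOR-FACTOR family `G p κ u x z a b = c₀·(g p z b − g p x a)·F κ u x z a b` on a local stencil family `F` (`LocStencil F CF δF`) with a
block symbol `|g p| ≤ cg` supported in `|z − N • p|₁ ≤ W` — leaf-03 g66's §2 spelling of the (b1) slaved summand):
* §1 **`abs_e3K3_commFactor_le`** — leaf-03 g66's TWO-CENTRE BOUND `abs_e3OfK_commFactor_le` with the three kernel legs KEPT APART (her proof token for token; `Decays X ∕ Y ∕ Z`
  (common rate `δK`) used each at its own leg: `biLoc_comp_decays` ∕ `vertexFamily_vertexOfK` ∕ `biLoc_comp_right`):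
  `|e3K3 X Y Z N (G p) κ′ u′ x′ z′ a b| ≤ CX·CY·CZ·CF·|c₀|·Ψ(m)·e^{−(m∕2)|p − u′|₁}·e^{−(m∕8)(|x′ − u′|₁ + |z′ − u′|₁)}`, `m = min δF δK ∕ 2`,
  `Ψ(m) = |Fib|²·(2·cg·((d+1)·Zl(m))·e^{(m∕2)W})·Zl(m∕4)·Zl(m∕8)`; `locStencil_commFactor` (`LocStencil (G p) (2|c₀|·cg·CF) δF`); `abs_le_of_locStencil`.
* §2 `rows_of_twoCentre` — her recentring abstracted: a two-centre bound with constant `A` gives BOTH `LocStencil₂` rows at rate `m∕8` — passive `(_, p, κ′, u′) ↦ T p κ′ u′`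
  (leaf-02's three-way split) and active `(κ, u, _, p) ↦ T p κ u` (the block prefactor IS the separation weight).
* §3 **`abs_e3OfK_commFactor_sub_le`** — THE ONE-STEP DIFFERENCE, ENTRYWISE: for `Decays K ∕ K′` (constant `CK`) with `Decays (K′ − K) CD δK`, `LocStencil F ∕ F′` (constant
  `CF`) with `LocStencil (F′ − F) CFd δF`, and `G ∕ G′` in factor form on `F ∕ F′` with the SAME `c₀`, `g`: `e3OfK N K′ (G′ p) − e3OfK N K (G p)` = leaf-03 g15's
  `e3K3_sub_telescope` in the legs (`(K′−K) K′ K′ + K (K′−K) K′ + K K (K′−K)` on `G′ p`) + d1's `WardResidualSUnroll.e3OfK_add_of_bdd` in the table (`K K K` on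
  `(G′ − G) p`, a factor-form family on `F′ − F`) ⇒ §1 four times ⇒ `≤ (3·CD·CK²·CF + CK³·CFd)·|c₀|·Ψ(m)·(two-centre weights)`; **`driftRows_of_rows`** — BOTH rows of the
  one-step difference of the two-summand table `cout • (e3OfK N K (G p) + e3OfK N K (G₂ p))` (the `R ∕ R″` twins of the (b1) spelling share `F`): constant
  `2·|cout|·|c₀|·(3·CD·CK²·CF + CK³·CFd)·Ψ(m)`, rate `m∕8`.
Every kernel ∕ table row is a HYPOTHESIS (road P1's ∕ the D1 END's currency at the literal — PART 2); asserts NO value of any table of Bałaban's; discharges NOTHING of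
`hcelld` ∕ `hcell` ∕ (Q-L) ∕ (Q-S) ∕ (C) ∕ «T2Shape» ∕ «T2Drift» ∕ (hW, hWall); (β) of record untouched; NEVER «G-an2-4 closed» as (CONV-C); NOT D1, NOT `BetaPertH`, NOT
continuum, NOT Clay; not in print — our bookkeeping.  2026-08-23.
-/

noncomputable section

open Finset
open scoped BigOperators
open Literature.MathematicalPhysics.QuantumFieldTheory
open Literature.MathematicalPhysics.QuantumFieldTheory.Balaban1983to89
open Literature.MathematicalPhysics.QuantumFieldTheory.Balaban1983to89.Beta
open B12Sec2to5 (l1 l1_nonneg)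
open ExpKernelCalculus (MKer Site Decays BiLoc VertexFamily comp Zl Zl_nonneg l1_sub_triangle l1_sub_symm l1_natSmul biLoc_comp_decays)
open OneStepResolventKernel (Fib LocStencil wsum decays_mono biLoc_mono)
open OneStepKernelFamily (KInvStep vertexOfK colH vertexFamily_vertexOfK)
open BalabanStepJetsSucc (mmRead biLoc_comp_right biLoc_mmRead)
open BalabanCompositeJets (LocStencil₂)
open AffineAveraging (box toSite)
open Summit.QuantumFields.BalabanUV.Beta.BorderedHessian (diagK)
open Summit.QuantumFields.BalabanUV.Beta.HessKerDressedUnits (unitK unitS)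
open Summit.QuantumFields.BalabanUV.Beta.SpineRooted (SpureRecAt e3OfK e3OfK_apply)
open Summit.QuantumFields.BalabanUV.Beta.GAN24.SlavedSummandLetterRows (biLoc_commFactor vertexOfK_commFactor evenLetterTable_eq_commFactor)
open Summit.QuantumFields.BalabanUV.Beta.GAN24.ThirdJetThreeKernel (e3K3 e3K3_sub_telescope)
open Summit.QuantumFields.BalabanUV.Beta.GAN24.WardResidualSUnroll (e3OfK_add_of_bdd)

namespace Summit.QuantumFields.BalabanUV.Beta.GAN24.SlavedSummandLetterDriftRows

variable {d : ℕ}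

/-! ## §1 The two-centre bound for the third jet with three kernel legs -/

section ThreeLegs

variable {X Y Z : MKer (d + 1) (Fib d)} {N : ℕ} {CX CY CZ δK CF δF : ℝ} {F : Fin (d + 1) → Site (d + 1) → MKer (d + 1) (Fib d)}
  {G : Site (d + 1) → Fin (d + 1) → Site (d + 1) → MKer (d + 1) (Fib d)} {c₀ : ℝ} {g : Site (d + 1) → Site (d + 1) → Fib d → ℝ} {cg W : ℝ}

/-- NOT IN PRINT; OUR BOOKKEEPING ([folklore]; leaf-03 g66's `SlavedSummandLetterRows.abs_e3OfK_commFactor_le` with the three kernel legs of leaf-03 g15's `e3K3` kept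
apart — her proof token for token, each `Decays` hypothesis used at its own leg).  **THE TWO-CENTRE BOUND, THREE LEGS**: `|e3K3 X Y Z N (G p) κ′ u′ x′ z′ a b| ≤
CX·CY·CZ·CF·Φ(m) · e^{−(m∕2)|p − u′|₁} · e^{−(m∕8)(|x′ − u′|₁ + |z′ − u′|₁)}`, `m = min δF δK ∕ 2`, `Φ(m) = |Fib|²·(2|c₀|·cg·((d+1)·Zl(m))·e^{(m∕2)W})·Zl(m∕4)·Zl(m∕8)`. -/
theorem abs_e3K3_commFactor_le (hN : 1 ≤ N) (hX : Decays X CX δK) (hY : Decays Y CY δK) (hZ : Decays Z CZ δK) (hδK : 0 < δK)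
    (hF : LocStencil F CF δF) (hδF : 0 < δF)
    (hG : ∀ p κ u x z a b, G p κ u x z a b = c₀ * (g p z b - g p x a) * F κ u x z a b)
    (hgB : ∀ p z b, |g p z b| ≤ cg) (hgW : ∀ p z b, g p z b ≠ 0 → l1 (z - (N : ℤ) • p) ≤ W)
    (p : Site (d + 1)) (κ' : Fin (d + 1)) (u' x' z' : Site (d + 1)) (a b : Fib d) :
    |e3K3 X Y Z N (G p) κ' u' x' z' a b|
      ≤ CX * CY * CZ * CF * |c₀| * ((Fintype.card (Fib d) : ℝ) * (Fintype.card (Fib d) : ℝ)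
            * (2 * cg * (((d + 1 : ℕ) : ℝ) * Zl (d + 1) (min δF δK / 2)) * Real.exp (min δF δK / 2 / 2 * W))
            * Zl (d + 1) (min δF δK / 2 / 2 - min δF δK / 2 / 4) * Zl (d + 1) (min δF δK / 2 / 4 - min δF δK / 2 / 8))
        * Real.exp (-(min δF δK / 2 / 2) * l1 (p - u')) * Real.exp (-(min δF δK / 2 / 8) * (l1 (x' - u') + l1 (z' - u'))) := by
  set m : ℝ := min δF δK / 2 with hm
  have hm0 : 0 < m := by rw [hm]; exact half_pos (lt_min hδF hδK)
  have hCX : 0 ≤ CX := hX.nonneg (Sum.inl 0)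
  have hCY : 0 ≤ CY := hY.nonneg (Sum.inl 0)
  have hCZ : 0 ≤ CZ := hZ.nonneg (Sum.inl 0)
  have hCF : 0 ≤ CF := (hF 0 0).nonneg (Sum.inl 0)
  have hcg : 0 ≤ cg := (abs_nonneg _).trans (hgB 0 0 (Sum.inl 0))
  have hmin : min δF δK ≤ δK := min_le_right _ _
  have hmin' : min δF δK ≤ δF := min_le_left _ _
  have hF' : LocStencil F CF (min δF δK) := fun κ u => biLoc_mono (hF κ u) hCF hmin'
  have hV : VertexFamily (vertexOfK Y N F) N (((d + 1 : ℕ) : ℝ) * (CY * CF * Zl (d + 1) (min δF δK / 2))) (min δF δK / 2) :=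
    vertexFamily_vertexOfK (N := N) hY hCY hF' (lt_min hδF hδK) hmin
  have hVu : BiLoc (vertexOfK Y N F κ' u') ((N : ℤ) • u') ((N : ℤ) • u') (((d + 1 : ℕ) : ℝ) * (CY * CF * Zl (d + 1) m)) m := hV κ' u'
  have hVg : BiLoc (vertexOfK Y N (G p) κ' u') ((N : ℤ) • u') ((N : ℤ) • u')
      (2 * |c₀| * cg * (((d + 1 : ℕ) : ℝ) * (CY * CF * Zl (d + 1) m)) * Real.exp (m / 2 * W) * Real.exp (-(m / 2) * l1 ((N : ℤ) • p - (N : ℤ) • u'))) (m / 2) := by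
    have h := biLoc_commFactor (q := (N : ℤ) • p) hVu hm0.le (hgB p) (hgW p) c₀
    intro x z a₁ b₁
    rw [vertexOfK_commFactor (hG p) κ' u' x z a₁ b₁]
    exact h x z a₁ b₁
  have hXm2 : Decays X CX (m / 2) := decays_mono hX hCX le_rfl (by rw [hm]; linarith)
  have hZm4 : Decays Z CZ (m / 4) := decays_mono hZ hCZ le_rfl (by rw [hm]; linarith)
  have h1 := biLoc_comp_decays hXm2 hVg (show 0 ≤ m / 4 by positivity) (by linarith)
  have h2 := biLoc_comp_right h1 hZm4 (show 0 ≤ m / 8 by positivity) (by linarith)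
  have h3 := biLoc_mmRead hN h2 (by positivity) x' z' a b
  rw [show e3K3 X Y Z N (G p) κ' u' x' z' a b = -(mmRead N (comp (comp X (vertexOfK Y N (G p) κ' u')) Z) x' z' a b) from rfl, abs_neg]
  refine h3.trans ?_
  have hNp : l1 (p - u') ≤ l1 ((N : ℤ) • p - (N : ℤ) • u') := by
    rw [← smul_sub, l1_natSmul]
    have h1N : (1 : ℝ) ≤ N := by exact_mod_cast hN
    have := l1_nonneg (p - u')
    nlinarith
  have hexp : Real.exp (-(m / 2) * l1 ((N : ℤ) • p - (N : ℤ) • u')) ≤ Real.exp (-(m / 2) * l1 (p - u')) :=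
    Real.exp_le_exp.2 (by nlinarith)
  have hZ0 : 0 ≤ Zl (d + 1) m := Zl_nonneg hm0
  have hZ1 : 0 ≤ Zl (d + 1) (m / 2 - m / 4) := Zl_nonneg (by linarith)
  have hZ2 : 0 ≤ Zl (d + 1) (m / 4 - m / 8) := Zl_nonneg (by linarith)
  have hA : 0 ≤ (Fintype.card (Fib d) : ℝ) * ((Fintype.card (Fib d) : ℝ) * (CX * (2 * |c₀| * cg * (((d + 1 : ℕ) : ℝ) * (CY * CF * Zl (d + 1) m))
      * Real.exp (m / 2 * W))) * Zl (d + 1) (m / 2 - m / 4) * CZ) * Zl (d + 1) (m / 4 - m / 8) := by positivity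
  have key := mul_le_mul_of_nonneg_right (mul_le_mul_of_nonneg_left hexp hA) (Real.exp_pos (-(m / 8) * (l1 (x' - u') + l1 (z' - u')))).le
  convert key using 1 <;> ring

/-- [folklore] **A FACTOR-FORM FAMILY IS A LOCAL STENCIL FAMILY**: `|g| ≤ cg` and `LocStencil F CF δF` give `LocStencil (G p) (2|c₀|·cg·CF) δF`. -/
theorem locStencil_commFactor (hF : LocStencil F CF δF) (hG : ∀ p κ u x z a b, G p κ u x z a b = c₀ * (g p z b - g p x a) * F κ u x z a b)
    (hgB : ∀ p z b, |g p z b| ≤ cg) (p : Site (d + 1)) : LocStencil (G p) (2 * |c₀| * cg * CF) δF := by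
  intro κ u x z a b
  have h1 := hF κ u x z a b
  have hcg : 0 ≤ cg := (abs_nonneg _).trans (hgB p 0 (Sum.inl 0))
  have h2 : |g p z b - g p x a| ≤ 2 * cg := (abs_sub _ _).trans (by linarith [hgB p z b, hgB p x a])
  rw [hG, abs_mul, abs_mul]
  have key := mul_le_mul (mul_le_mul_of_nonneg_left h2 (abs_nonneg c₀)) h1 (abs_nonneg _) (by positivity)
  refine key.trans (le_of_eq ?_)
  ring

/-- [folklore] A local stencil family is bounded entrywise by its constant (`0 ≤ δ`). -/
theorem abs_le_of_locStencil {S : Fin (d + 1) → Site (d + 1) → MKer (d + 1) (Fib d)} {C δ : ℝ} (hS : LocStencil S C δ) (hδ : 0 ≤ δ)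
    (κ : Fin (d + 1)) (u x z : Site (d + 1)) (a b : Fib d) : |S κ u x z a b| ≤ C := by
  have hC : 0 ≤ C := (hS κ u).nonneg (Sum.inl 0)
  refine (hS κ u x z a b).trans ?_
  have h1 : Real.exp (-δ * (l1 (x - u) + l1 (z - u))) ≤ 1 :=
    Real.exp_le_one_iff.2 (by nlinarith [l1_nonneg (x - u), l1_nonneg (z - u)])
  calc C * Real.exp (-δ * (l1 (x - u) + l1 (z - u))) ≤ C * 1 := mul_le_mul_of_nonneg_left h1 hC
    _ = C := mul_one C

/-! ## §2 Rows from a two-centre bound -/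

/-- [folklore] **A TWO-CENTRE BOUND GIVES BOTH LETTER ROWS** (leaf-03 g66's recentring, abstracted): if
`|T p κ′ u′ x′ z′ a b| ≤ A·e^{−(m∕2)|p − u′|₁}·e^{−(m∕8)(|x′ − u′|₁ + |z′ − u′|₁)}` (`0 ≤ A`, `0 ≤ m`) then the PASSIVE table `(_, p, κ′, u′) ↦ T p κ′ u′` and the
ACTIVE table `(κ, u, _, p) ↦ T p κ u` are both `LocStencil₂ · A (m∕8)`. -/
theorem rows_of_twoCentre {T : Site (d + 1) → Fin (d + 1) → Site (d + 1) → MKer (d + 1) (Fib d)} {A m : ℝ} (hA : 0 ≤ A) (hm : 0 ≤ m)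
    (h : ∀ p κ' u' x' z' a b, |T p κ' u' x' z' a b| ≤ A * Real.exp (-(m / 2) * l1 (p - u')) * Real.exp (-(m / 8) * (l1 (x' - u') + l1 (z' - u')))) :
    LocStencil₂ (fun (_ : Fin (d + 1)) (p : Site (d + 1)) (κ' : Fin (d + 1)) (u' : Site (d + 1)) => T p κ' u') A (m / 8)
    ∧ LocStencil₂ (fun (κ : Fin (d + 1)) (u : Site (d + 1)) (_ : Fin (d + 1)) (p : Site (d + 1)) => T p κ u) A (m / 8) := by
  constructor
  · intro _ p κ' u' x' z' a b
    refine (h p κ' u' x' z' a b).trans ?_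
    have hE : Real.exp (-(m / 2) * l1 (p - u')) * Real.exp (-(m / 8) * (l1 (x' - u') + l1 (z' - u')))
        ≤ Real.exp (-(m / 8) * l1 (u' - p)) * Real.exp (-(m / 8) * (l1 (x' - p) + l1 (z' - p))) := by
      rw [← Real.exp_add, ← Real.exp_add]
      refine Real.exp_le_exp.2 ?_
      have t1 : l1 (x' - p) ≤ l1 (x' - u') + l1 (u' - p) := l1_sub_triangle x' u' p
      have t2 : l1 (z' - p) ≤ l1 (z' - u') + l1 (u' - p) := l1_sub_triangle z' u' p
      rw [l1_sub_symm p u']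
      have h0 := l1_nonneg (u' - p)
      nlinarith
    calc A * Real.exp (-(m / 2) * l1 (p - u')) * Real.exp (-(m / 8) * (l1 (x' - u') + l1 (z' - u')))
        = A * (Real.exp (-(m / 2) * l1 (p - u')) * Real.exp (-(m / 8) * (l1 (x' - u') + l1 (z' - u')))) := by ring
      _ ≤ A * (Real.exp (-(m / 8) * l1 (u' - p)) * Real.exp (-(m / 8) * (l1 (x' - p) + l1 (z' - p)))) := mul_le_mul_of_nonneg_left hE hA
      _ = A * Real.exp (-(m / 8) * l1 (u' - p)) * Real.exp (-(m / 8) * (l1 (x' - p) + l1 (z' - p))) := by ring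
  · intro κ u _ p x' z' a b
    refine (h p κ u x' z' a b).trans ?_
    have hE : Real.exp (-(m / 2) * l1 (p - u)) ≤ Real.exp (-(m / 8) * l1 (p - u)) := by
      refine Real.exp_le_exp.2 ?_
      have h0 := l1_nonneg (p - u)
      nlinarith
    exact mul_le_mul_of_nonneg_right (mul_le_mul_of_nonneg_left hE hA) (Real.exp_pos _).le

end ThreeLegs

/-! ## §3 The one-step difference of the third jet of a commutator-factor family: telescoping in the three legs and in the table -/

section Drift

variable {K K' : MKer (d + 1) (Fib d)} {N : ℕ} {CK CD δK CF CFd δF : ℝ} {F F' : Fin (d + 1) → Site (d + 1) → MKer (d + 1) (Fib d)}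
  {G G' G₂ G₂' : Site (d + 1) → Fin (d + 1) → Site (d + 1) → MKer (d + 1) (Fib d)} {c₀ : ℝ} {g : Site (d + 1) → Site (d + 1) → Fib d → ℝ}
  {cg W : ℝ}

/-- NOT IN PRINT; OUR BOOKKEEPING ([folklore]: leaf-03 g15's `e3K3_sub_telescope` in the three kernel legs ⨾ d1's `e3OfK_add_of_bdd` in the table ⨾ §1 four times).
**THE ONE-STEP DIFFERENCE OF THE SLAVED THIRD JET, ENTRYWISE**: for two decaying kernels `K, K′` (constant `CK`, rate `δK`) with `Decays (K′ − K) CD δK`, two local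
families `F, F′` (constant `CF`, rate `δF`) with `LocStencil (F′ − F) CFd δF`, and the commutator-factor families `G p ∕ G′ p` built on `F ∕ F′` with the SAME scalar
`c₀` and block symbol `g` (`|g| ≤ cg`, support `|z − N • p|₁ ≤ W`):
`|e3OfK N K′ (G′ p) κ′ u′ x′ z′ a b − e3OfK N K (G p) κ′ u′ x′ z′ a b| ≤ (3·CD·CK²·CF + CK³·CFd)·|c₀|·Ψ(m)·e^{−(m∕2)|p − u′|₁}·e^{−(m∕8)(|x′ − u′|₁ + |z′ − u′|₁)}`. -/
theorem abs_e3OfK_commFactor_sub_le (hN : 1 ≤ N) (hK : Decays K CK δK) (hK' : Decays K' CK δK) (hD : Decays (K' - K) CD δK) (hδK : 0 < δK)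
    (hF : LocStencil F CF δF) (hF' : LocStencil F' CF δF) (hFd : LocStencil (F' - F) CFd δF) (hδF : 0 < δF)
    (hG : ∀ p κ u x z a b, G p κ u x z a b = c₀ * (g p z b - g p x a) * F κ u x z a b)
    (hG' : ∀ p κ u x z a b, G' p κ u x z a b = c₀ * (g p z b - g p x a) * F' κ u x z a b)
    (hgB : ∀ p z b, |g p z b| ≤ cg) (hgW : ∀ p z b, g p z b ≠ 0 → l1 (z - (N : ℤ) • p) ≤ W)
    (p : Site (d + 1)) (κ' : Fin (d + 1)) (u' x' z' : Site (d + 1)) (a b : Fib d) :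
    |e3OfK N K' (G' p) κ' u' x' z' a b - e3OfK N K (G p) κ' u' x' z' a b|
      ≤ (3 * CD * CK * CK * CF + CK * CK * CK * CFd) * |c₀| * ((Fintype.card (Fib d) : ℝ) * (Fintype.card (Fib d) : ℝ)
            * (2 * cg * (((d + 1 : ℕ) : ℝ) * Zl (d + 1) (min δF δK / 2)) * Real.exp (min δF δK / 2 / 2 * W))
            * Zl (d + 1) (min δF δK / 2 / 2 - min δF δK / 2 / 4) * Zl (d + 1) (min δF δK / 2 / 4 - min δF δK / 2 / 8))
        * Real.exp (-(min δF δK / 2 / 2) * l1 (p - u')) * Real.exp (-(min δF δK / 2 / 8) * (l1 (x' - u') + l1 (z' - u'))) := by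
  have hCK : 0 ≤ CK := hK.nonneg (Sum.inl 0)
  have hCF : 0 ≤ CF := (hF 0 0).nonneg (Sum.inl 0)
  -- the difference family is a factor-form family on `F′ − F`
  have hGd : ∀ p κ u x z a b, (fun p => G' p - G p) p κ u x z a b = c₀ * (g p z b - g p x a) * (F' - F) κ u x z a b := by
    intro p κ u x z a b
    simp only [Pi.sub_apply]
    rw [hG', hG]
    ring
  have hGp : LocStencil (G p) (2 * |c₀| * cg * CF) δF := locStencil_commFactor hF hG hgB p
  have hGp' : LocStencil (G' p) (2 * |c₀| * cg * CF) δF := locStencil_commFactor hF' hG' hgB p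
  have hGpd : LocStencil (G' p - G p) (2 * |c₀| * cg * CFd) δF := locStencil_commFactor (G := fun p => G' p - G p) hFd hGd hgB p
  have hGp'δ : LocStencil (G' p) (2 * |c₀| * cg * CF) (min δF δK) :=
    fun κ u => biLoc_mono (hGp' κ u) ((hGp' 0 0).nonneg (Sum.inl 0)) (min_le_left _ _)
  -- telescoping in the three legs (leaf-03 g15)
  have tele := e3K3_sub_telescope hK hK' hK hK' hK hK' hGp'δ (lt_min hδF hδK) (min_le_right _ _) N κ' u' x' z' a b
  -- additivity in the table (d1)
  have add : e3OfK N K (G' p) κ' u' = e3OfK N K (G p) κ' u' + e3OfK N K (G' p - G p) κ' u' := by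
    have e : (fun κ u => G p κ u + (G' p - G p) κ u) = G' p := by
      funext κ u
      simp only [Pi.sub_apply, add_sub_cancel]
    have h := e3OfK_add_of_bdd hK hδK hCK N (S := G p) (T := G' p - G p)
      (fun κ u x z a b => abs_le_of_locStencil hGp hδF.le κ u x z a b) (fun κ u x z a b => abs_le_of_locStencil hGpd hδF.le κ u x z a b) κ' u'
    rw [e] at h
    exact h
  have eq : e3OfK N K' (G' p) κ' u' x' z' a b - e3OfK N K (G p) κ' u' x' z' a b
      = e3K3 (K' - K) K' K' N (G' p) κ' u' x' z' a b + e3K3 K (K' - K) K' N (G' p) κ' u' x' z' a b + e3K3 K K (K' - K) N (G' p) κ' u' x' z' a b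
        + e3K3 K K K N ((fun p => G' p - G p) p) κ' u' x' z' a b := by
    have a1 : e3OfK N K (G' p) κ' u' x' z' a b = e3OfK N K (G p) κ' u' x' z' a b + e3OfK N K (G' p - G p) κ' u' x' z' a b := by
      rw [add]; rfl
    have r1 : e3OfK N K' (G' p) κ' u' x' z' a b = e3K3 K' K' K' N (G' p) κ' u' x' z' a b := rfl
    have r2 : e3OfK N K (G' p) κ' u' x' z' a b = e3K3 K K K N (G' p) κ' u' x' z' a b := rfl
    have r3 : e3OfK N K (G' p - G p) κ' u' x' z' a b = e3K3 K K K N ((fun p => G' p - G p) p) κ' u' x' z' a b := rfl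
    linarith [tele, a1, r1, r2, r3]
  rw [eq]
  have h1 := abs_e3K3_commFactor_le hN hD hK' hK' hδK hF' hδF hG' hgB hgW p κ' u' x' z' a b
  have h2 := abs_e3K3_commFactor_le hN hK hD hK' hδK hF' hδF hG' hgB hgW p κ' u' x' z' a b
  have h3 := abs_e3K3_commFactor_le hN hK hK hD hδK hF' hδF hG' hgB hgW p κ' u' x' z' a b
  have h4 := abs_e3K3_commFactor_le (G := fun p => G' p - G p) hN hK hK hK hδK hFd hδF hGd hgB hgW p κ' u' x' z' a b
  refine (abs_add_le _ _).trans (((add_le_add ((abs_add_le _ _).trans (add_le_add ((abs_add_le _ _).trans (add_le_add h1 h2)) h3)) h4)).trans (le_of_eq ?_))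
  ring

/-- NOT IN PRINT; OUR BOOKKEEPING (§3 twice ⨾ §2).  **THE DRIFT ROWS OF THE TWO-SUMMAND SLAVED TABLE** `E(p) := cout • (e3OfK N K (G p) + e3OfK N K (G₂ p))` (two factor-form
families `G, G₂` on the SAME `F` — the `R ∕ R″` twins of the (b1) spelling) between `(K, F)` and `(K′, F′)`: both `LocStencil₂` rows of `E′(p) − E(p)` — passive
`(_, p, κ′, u′) ↦ …` and active `(κ, u, _, p) ↦ …` — with constant `2·|cout|·|c₀|·(3·CD·CK²·CF + CK³·CFd)·Ψ(m)` and rate `m∕8`, `m = min δF δK ∕ 2`. -/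
theorem driftRows_of_rows (hN : 1 ≤ N) (hK : Decays K CK δK) (hK' : Decays K' CK δK) (hD : Decays (K' - K) CD δK) (hδK : 0 < δK)
    (hF : LocStencil F CF δF) (hF' : LocStencil F' CF δF) (hFd : LocStencil (F' - F) CFd δF) (hδF : 0 < δF)
    (hG : ∀ p κ u x z a b, G p κ u x z a b = c₀ * (g p z b - g p x a) * F κ u x z a b)
    (hG' : ∀ p κ u x z a b, G' p κ u x z a b = c₀ * (g p z b - g p x a) * F' κ u x z a b)
    (hG₂ : ∀ p κ u x z a b, G₂ p κ u x z a b = c₀ * (g p z b - g p x a) * F κ u x z a b)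
    (hG₂' : ∀ p κ u x z a b, G₂' p κ u x z a b = c₀ * (g p z b - g p x a) * F' κ u x z a b)
    (hgB : ∀ p z b, |g p z b| ≤ cg) (hgW : ∀ p z b, g p z b ≠ 0 → l1 (z - (N : ℤ) • p) ≤ W) (cout : ℝ) :
    LocStencil₂ (fun (_ : Fin (d + 1)) (p : Site (d + 1)) (κ' : Fin (d + 1)) (u' : Site (d + 1)) =>
        cout • (e3OfK N K' (G' p) κ' u' + e3OfK N K' (G₂' p) κ' u') - cout • (e3OfK N K (G p) κ' u' + e3OfK N K (G₂ p) κ' u'))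
      (2 * |cout| * |c₀| * (3 * CD * CK * CK * CF + CK * CK * CK * CFd) * ((Fintype.card (Fib d) : ℝ) * (Fintype.card (Fib d) : ℝ)
            * (2 * cg * (((d + 1 : ℕ) : ℝ) * Zl (d + 1) (min δF δK / 2)) * Real.exp (min δF δK / 2 / 2 * W))
            * Zl (d + 1) (min δF δK / 2 / 2 - min δF δK / 2 / 4) * Zl (d + 1) (min δF δK / 2 / 4 - min δF δK / 2 / 8)))
      (min δF δK / 2 / 8)
    ∧ LocStencil₂ (fun (κ : Fin (d + 1)) (u : Site (d + 1)) (_ : Fin (d + 1)) (p : Site (d + 1)) =>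
        cout • (e3OfK N K' (G' p) κ u + e3OfK N K' (G₂' p) κ u) - cout • (e3OfK N K (G p) κ u + e3OfK N K (G₂ p) κ u))
      (2 * |cout| * |c₀| * (3 * CD * CK * CK * CF + CK * CK * CK * CFd) * ((Fintype.card (Fib d) : ℝ) * (Fintype.card (Fib d) : ℝ)
            * (2 * cg * (((d + 1 : ℕ) : ℝ) * Zl (d + 1) (min δF δK / 2)) * Real.exp (min δF δK / 2 / 2 * W))
            * Zl (d + 1) (min δF δK / 2 / 2 - min δF δK / 2 / 4) * Zl (d + 1) (min δF δK / 2 / 4 - min δF δK / 2 / 8)))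
      (min δF δK / 2 / 8) := by
  have hCK : 0 ≤ CK := hK.nonneg (Sum.inl 0)
  have hCD : 0 ≤ CD := hD.nonneg (Sum.inl 0)
  have hCF : 0 ≤ CF := (hF 0 0).nonneg (Sum.inl 0)
  have hCFd : 0 ≤ CFd := (hFd 0 0).nonneg (Sum.inl 0)
  have hcg : 0 ≤ cg := (abs_nonneg _).trans (hgB 0 0 (Sum.inl 0))
  have hm : 0 < min δF δK / 2 := half_pos (lt_min hδF hδK)
  have hZ0 : 0 ≤ Zl (d + 1) (min δF δK / 2) := Zl_nonneg hm
  have hZ1 : 0 ≤ Zl (d + 1) (min δF δK / 2 / 2 - min δF δK / 2 / 4) := Zl_nonneg (by linarith)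
  have hZ2 : 0 ≤ Zl (d + 1) (min δF δK / 2 / 4 - min δF δK / 2 / 8) := Zl_nonneg (by linarith)
  set Ψ : ℝ := (Fintype.card (Fib d) : ℝ) * (Fintype.card (Fib d) : ℝ)
            * (2 * cg * (((d + 1 : ℕ) : ℝ) * Zl (d + 1) (min δF δK / 2)) * Real.exp (min δF δK / 2 / 2 * W))
            * Zl (d + 1) (min δF δK / 2 / 2 - min δF δK / 2 / 4) * Zl (d + 1) (min δF δK / 2 / 4 - min δF δK / 2 / 8) with hΨ
  have hΨ0 : 0 ≤ Ψ := by rw [hΨ]; positivity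
  have hB : 0 ≤ 2 * |cout| * |c₀| * (3 * CD * CK * CK * CF + CK * CK * CK * CFd) * Ψ := by positivity
  refine rows_of_twoCentre (T := fun p κ u => cout • (e3OfK N K' (G' p) κ u + e3OfK N K' (G₂' p) κ u) - cout • (e3OfK N K (G p) κ u + e3OfK N K (G₂ p) κ u))
    hB hm.le fun p κ' u' x' z' a b => ?_
  have d1 := abs_e3OfK_commFactor_sub_le hN hK hK' hD hδK hF hF' hFd hδF hG hG' hgB hgW p κ' u' x' z' a b
  have d2 := abs_e3OfK_commFactor_sub_le hN hK hK' hD hδK hF hF' hFd hδF hG₂ hG₂' hgB hgW p κ' u' x' z' a b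
  rw [← hΨ] at d1 d2
  have e : (cout • (e3OfK N K' (G' p) κ' u' + e3OfK N K' (G₂' p) κ' u') - cout • (e3OfK N K (G p) κ' u' + e3OfK N K (G₂ p) κ' u')) x' z' a b
      = cout * ((e3OfK N K' (G' p) κ' u' x' z' a b - e3OfK N K (G p) κ' u' x' z' a b)
          + (e3OfK N K' (G₂' p) κ' u' x' z' a b - e3OfK N K (G₂ p) κ' u' x' z' a b)) := by
    simp only [Pi.smul_apply, Pi.add_apply, Pi.sub_apply, smul_eq_mul]
    ring
  rw [e, abs_mul]
  have key := mul_le_mul_of_nonneg_left ((abs_add_le _ _).trans (add_le_add d1 d2)) (abs_nonneg cout)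
  refine key.trans (le_of_eq ?_)
  ring

end Drift

end Summit.QuantumFields.BalabanUV.Beta.GAN24.SlavedSummandLetterDriftRows

end
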